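import Literature.AlgebraicGeometry.Motives.HodgeLieWeightOnePlusLineBasis
import Literature.AlgebraicGeometry.Motives.SpanCInvariantForms
import Literature.Algebra.Lie.InvariantFormSimpleRadical
import HarnessLib

/-!
# Weight one, type-III position, `Lie Hg` `ℚ`-simple: `8 · tr_V(XY) = dim V · κ(X, Y)` on the Hodge Lie algebra

Family `hodge`, layer `Literature/AlgebraicGeometry/Motives`; THEOREMS ONLY (no definition, no named fact; D-0026).
Sequel of `HodgeLieWeightOnePlusLineIdeal` for the cell `pub-hodgecm2` (COR-CM) lane MT-RANK-SEVEN-TYPEIII, seat `b27`.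

SETTING (the type-III position): `H` polarizable of weight `1` on `V`, graded basis `e`, `P` the Hodge projector,
`𝔤 = 𝔥_ℂ = 𝔰 ⊕ 𝔨` with `𝔰 = ⟨E, F, Θ⟩` (`E F = αP`, `F E = α(1 − P)`) and `𝔨` its centraliser (`HodgeLieWeightOnePlusLineIdeal`),
`𝔷 = 0`, and `𝔥 = Lie Hg(H)` a SIMPLE Lie algebra over `ℚ`.

THE GALOIS SWAP BY RATIONAL INVARIANT FORMS.  `𝔰` and `𝔨` are the two simple factors of `𝔥 ⊗ ℂ`, forms of each other
under `Gal(K/ℚ)` for the centroid `K` of `𝔥`; instead of a semilinear twist we compare them through the two RATIONAL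
invariant symmetric bilinear forms on `𝔥`: the trace form `τ(X, Y) = tr_V(XY)` of `V` and the Killing form `κ`.  Since `𝔥`
is simple, `β = 8τ − (dim V)κ` is zero as soon as it is degenerate (`InvariantFormSimpleRadical`), and degeneracy may be
tested after `⊗ ℂ` (`SpanCInvariantForms`): the vector `E` lies in the radical of `β_ℂ`, because in the basis
`(E, F, Θ, k₁, …)` of `𝔤` one has `κ_ℂ(F, E) = 4α`, `κ_ℂ(E, E) = κ_ℂ(Θ, E) = κ_ℂ(k, E) = 0` (ad-traces) and
`tr(F E) = α dim V / 2`, `tr(E E) = tr(Θ E) = tr(k E) = 0` (the trace table).  Hence: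

* **`eight_mul_trace_mul_eq_finrank_mul_killingForm`** — for every Lie subalgebra `𝔏 ≤ 𝔤𝔩_ℚ(V)` with carrier `Lie Hg(H)`
  and all `X, Y ∈ 𝔏`: `8 · tr_V(X Y) = dim_ℚ V · κ_𝔏(X, Y)`.
* **`eight_mul_trace_mul_eq_finrank_mul_killingForm_spanC`** — the same for every Lie subalgebra `𝔏' ≤ 𝔤𝔩_ℂ(V_ℂ)` with
  carrier `𝔥_ℂ` (in particular on the compact factor `𝔨`, whose own representation on `V_ℂ` is thereby tied to the
  standard representation of `𝔰`: the sequel `HodgeLieWeightOnePlusLineCasimir`).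
* (the adapted basis and the column `κ_ℂ(·, E)`: companion file `HodgeLieWeightOnePlusLineBasis`.)

## References

* [MoonenZarhin1999LowDim] B. Moonen, Yu. Zarhin, *Hodge classes on abelian varieties of low dimension*, Math. Ann. 315
  (1999), §2 (2.3) Type III.
* [Deligne1982HodgeCycles] P. Deligne, *Hodge cycles on abelian varieties*, LNM 900 (1982), I §3 (3.4–3.6).
* [Jacobson1962LieAlgebras] N. Jacobson, *Lie Algebras* (1962), Ch. X §1 (centroid, forms of a Lie algebra), Ch. III §4.
* [Humphreys1972] J. E. Humphreys, GTM 9 (1972), §5.1 (Killing form), §8.1.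
-/

noncomputable section

open scoped TensorProduct

namespace Literature.AlgebraicGeometry.Motives

universe u

namespace HodgeStructure

open ProjectorBlocks Literature.RepresentationTheory.GeneralLinear

variable {V : Type u} [AddCommGroup V] [Module ℚ V] [Module.Finite ℚ V] [HodgeTensorFacts.{u, u}] {n : ℤ}
  {S : Type u} [Fintype S] [DecidableEq S] {deg : S → ℤ}

/-! ## §3 `8 tr_V(XY) = dim V · κ(X, Y)` on `Lie Hg` (rational) and on `𝔥_ℂ` -/

/-- **`8 · tr_V(X Y) = dim_ℚ V · κ(X, Y)` for all `X, Y` in the `ℚ`-SIMPLE Hodge Lie algebra of a weight-one polarizable Hodge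
structure in the type-III position** (`𝔷 = 0`, `dim 𝔤⁺ = 1`): the rational invariant form `β = 8 · tr_V − dim V · κ` on the simple
Lie algebra `Lie Hg` has `E` in the radical of its complexification (`finrank_mul_killingForm_projE`), so it is degenerate
(`exists_ne_zero_orthogonal_of_spanC`), hence zero (`eq_zero_of_isSimple_of_orthogonal`).  This is the rational shadow of the
Galois symmetry between the two complex factors `𝔰 ≅ 𝔨` of `Lie Hg ⊗ ℂ`. [cite: MoonenZarhin1999LowDim, §2 (2.3)]
[cite: Jacobson1962LieAlgebras, Ch. X §1 and Ch. III §4] [cite: Deligne1982HodgeCycles, I §3 (3.4–3.6)] -/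
theorem eight_mul_trace_mul_eq_finrank_mul_killingForm (H : HodgeStructure V n) (ψ : H.Polarization) (hn : n = 1)
    (e : Module.Basis S ℂ (ℂ ⊗[ℚ] V)) (hF : ∀ a, H.F a = Submodule.span ℂ (e '' {σ | a ≤ deg σ}))
    (hFc : ∀ a, complexConj (H.F a) = Submodule.span ℂ (e '' {σ | deg σ ≤ n - a}))
    (hdeg : ∀ σ, deg σ = 0 ∨ deg σ = 1) {X : Module.End ℚ V} (hX : X ∈ H.hodgeLie) (hXE : X ∉ H.endAlg)
    (hplus : ∀ Y ∈ H.hodgeLieC, ∃ c : ℂ,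
      gradingEnd e deg * Y * (1 - gradingEnd e deg) = c • (gradingEnd e deg * X.baseChange ℂ * (1 - gradingEnd e deg)))
    (hminus : ∀ Y ∈ H.hodgeLieC, ∃ c : ℂ,
      (1 - gradingEnd e deg) * Y * gradingEnd e deg = c • ((1 - gradingEnd e deg) * X.baseChange ℂ * gradingEnd e deg))
    (hz : H.hodgeLie ⊓ Subalgebra.toSubmodule H.endAlg = ⊥)
    (hsimple : letI : LieRing (Module.End ℚ V) := LieRing.ofAssociativeRing
      ∀ 𝔏 : LieSubalgebra ℚ (Module.End ℚ V), 𝔏.toSubmodule = H.hodgeLie → LieAlgebra.IsSimple ℚ 𝔏) :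
    letI : LieRing (Module.End ℚ V) := LieRing.ofAssociativeRing
    ∀ (𝔏 : LieSubalgebra ℚ (Module.End ℚ V)), 𝔏.toSubmodule = H.hodgeLie → ∀ X₁ Y₁ : 𝔏,
      8 * LinearMap.trace ℚ V ((X₁ : Module.End ℚ V) * Y₁) = (Module.finrank ℚ V : ℚ) * killingForm ℚ 𝔏 X₁ Y₁ := by
  letI : LieRing (Module.End ℚ V) := LieRing.ofAssociativeRing
  letI : LieRing (Module.End ℂ (ℂ ⊗[ℚ] V)) := LieRing.ofAssociativeRing
  intro 𝔏 h𝔏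
  classical
  haveI := hsimple 𝔏 h𝔏
  -- the complexified Lie algebra `𝔏'` with carrier `𝔥_ℂ`
  obtain ⟨𝔏', h𝔏'⟩ : ∃ 𝔏' : LieSubalgebra ℂ (Module.End ℂ (ℂ ⊗[ℚ] V)), 𝔏'.toSubmodule = H.hodgeLieC :=
    ⟨{ H.hodgeLieC with
        lie_mem' := fun {a b} ha hb => by
          rw [LieRing.of_associative_ring_bracket]
          exact H.commutator_mem_hodgeLieC ha hb }, rfl⟩
  have h𝔏'' : 𝔏'.toSubmodule = spanC 𝔏.toSubmodule := by rw [h𝔏', h𝔏, hodgeLieC_eq_spanC]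
  -- the rational form `β = 8 τ − d κ`
  obtain ⟨β, hβ⟩ : ∃ β : LinearMap.BilinForm ℚ 𝔏,
      β = (8 : ℚ) • LieModule.traceForm ℚ 𝔏 V - (Module.finrank ℚ V : ℚ) • killingForm ℚ 𝔏 := ⟨_, rfl⟩
  have hβapply : ∀ X₁ Y₁ : 𝔏, β X₁ Y₁ =
      8 * LinearMap.trace ℚ V ((X₁ : Module.End ℚ V) * Y₁) - (Module.finrank ℚ V : ℚ) * killingForm ℚ 𝔏 X₁ Y₁ := by
    intro X₁ Y₁
    rw [hβ, LinearMap.sub_apply, LinearMap.smul_apply, LinearMap.smul_apply, LinearMap.sub_apply, LinearMap.smul_apply,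
      LinearMap.smul_apply, LieModule.traceForm_apply_apply, smul_eq_mul, smul_eq_mul]
    rfl
  have hβinv : β.lieInvariant 𝔏 := by
    intro x y z
    rw [hβapply, hβapply]
    have h1 := LieModule.traceForm_lieInvariant ℚ 𝔏 V x y z
    have h2 := LieModule.traceForm_lieInvariant ℚ 𝔏 𝔏 x y z
    rw [LieModule.traceForm_apply_apply, LieModule.traceForm_apply_apply] at h1
    change LinearMap.trace ℚ V ((⁅x, y⁆ : 𝔏) * (z : Module.End ℚ V)) =
      -LinearMap.trace ℚ V ((y : Module.End ℚ V) * (⁅x, z⁆ : 𝔏)) at h1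
    rw [h1]
    change _ - _ * LieModule.traceForm ℚ 𝔏 𝔏 _ _ = -(_ - _ * LieModule.traceForm ℚ 𝔏 𝔏 _ _)
    rw [h2]
    ring
  -- the test vector `E` and the complex form
  obtain ⟨hEM, -⟩ := projE_mem_hodgeLieC H e hF hFc hdeg (H.baseChange_mem_hodgeLieC hX)
  have hEM' : gradingEnd e deg * X.baseChange ℂ * (1 - gradingEnd e deg) ∈ 𝔏' := by
    rw [← LieSubalgebra.mem_toSubmodule, h𝔏']; exact hEM
  obtain ⟨E', hE'⟩ : ∃ E' : 𝔏', (E' : Module.End ℂ (ℂ ⊗[ℚ] V)) =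
      gradingEnd e deg * X.baseChange ℂ * (1 - gradingEnd e deg) := ⟨⟨_, hEM'⟩, rfl⟩
  have hE'0 : E' ≠ 0 := by
    intro h0
    apply (projE_ne_zero_of_not_mem_endAlg H hn e hF hFc hdeg hXE).1
    rw [← hE', h0]
    exact ZeroMemClass.coe_zero _
  obtain ⟨β', hβ'⟩ : ∃ β' : 𝔏'.toSubmodule → 𝔏'.toSubmodule → ℂ, ∀ x y, β' x y =
      8 * LinearMap.trace ℂ (ℂ ⊗[ℚ] V) ((x : Module.End ℂ (ℂ ⊗[ℚ] V)) * y) -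
        (Module.finrank ℚ V : ℂ) * killingForm ℂ 𝔏' ⟨x.1, x.2⟩ ⟨y.1, y.2⟩ := ⟨_, fun _ _ => rfl⟩
  have hβ'add : ∀ y x x' : 𝔏'.toSubmodule, β' y (x + x') = β' y x + β' y x' := by
    intro y x x'
    have hsplit : (⟨(x + x').1, (x + x').2⟩ : 𝔏') = ⟨x.1, x.2⟩ + ⟨x'.1, x'.2⟩ := rfl
    rw [hβ', hβ', hβ', hsplit, map_add, Submodule.coe_add, mul_add, map_add]
    ring
  have hβ'smul : ∀ (c : ℂ) (y x : 𝔏'.toSubmodule), β' y (c • x) = c * β' y x := by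
    intro c y x
    have hsplit : (⟨(c • x).1, (c • x).2⟩ : 𝔏') = c • ⟨x.1, x.2⟩ := rfl
    rw [hβ', hβ', hsplit, map_smul, Submodule.coe_smul, mul_smul_comm, map_smul, smul_eq_mul, smul_eq_mul]
    ring
  have hβ'add' : ∀ x x' y : 𝔏'.toSubmodule, β' (x + x') y = β' x y + β' x' y := by
    intro x x' y
    have hsplit : (⟨(x + x').1, (x + x').2⟩ : 𝔏') = ⟨x.1, x.2⟩ + ⟨x'.1, x'.2⟩ := rfl
    rw [hβ', hβ', hβ', hsplit, LinearMap.map_add₂, Submodule.coe_add, add_mul, map_add]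
    ring
  have hβ'smul' : ∀ (c : ℂ) (x y : 𝔏'.toSubmodule), β' (c • x) y = c * β' x y := by
    intro c x y
    have hsplit : (⟨(c • x).1, (c • x).2⟩ : 𝔏') = c • ⟨x.1, x.2⟩ := rfl
    rw [hβ', hβ', hsplit, LinearMap.map_smul₂, Submodule.coe_smul, smul_mul_assoc, map_smul, smul_eq_mul, smul_eq_mul]
    ring
  have hcol := finrank_mul_killingForm_projE H ψ hn e hF hFc hdeg hX hXE hplus hminus hz 𝔏' h𝔏' E' hE'
  have hEeta : (⟨E'.1, E'.2⟩ : 𝔏') = E' := rfl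
  have hrad : ∀ y' : 𝔏'.toSubmodule, β' y' ⟨E'.1, E'.2⟩ = 0 := by
    intro y'
    have h := hcol ⟨y'.1, y'.2⟩
    simp only [hβ', hEeta]
    linear_combination -h
  have hcompat : ∀ (X₁ Y₁ : 𝔏.toSubmodule) (hX₁ : (X₁ : Module.End ℚ V).baseChange ℂ ∈ 𝔏'.toSubmodule)
      (hY₁ : (Y₁ : Module.End ℚ V).baseChange ℂ ∈ 𝔏'.toSubmodule), β' ⟨_, hX₁⟩ ⟨_, hY₁⟩ = algebraMap ℚ ℂ (β X₁ Y₁) := by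
    intro X₁ Y₁ hX₁ hY₁
    have hK := killingForm_spanC 𝔏 𝔏' h𝔏'' X₁ Y₁ ⟨_, hX₁⟩ ⟨_, hY₁⟩ rfl rfl
    rw [hβ', hβapply]
    change 8 * LinearMap.trace ℂ (ℂ ⊗[ℚ] V) ((X₁ : Module.End ℚ V).baseChange ℂ * (Y₁ : Module.End ℚ V).baseChange ℂ) -
      (Module.finrank ℚ V : ℂ) * killingForm ℂ 𝔏' ⟨_, hX₁⟩ ⟨_, hY₁⟩ = _
    rw [hK, ← LinearMap.baseChange_mul, LinearMap.trace_baseChange]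
    simp only [map_sub, map_mul, map_natCast, map_ofNat]
  -- descent, simplicity, and the conclusion
  obtain ⟨x, hx0, hxrad⟩ := exists_ne_zero_orthogonal_of_spanC 𝔏.toSubmodule 𝔏'.toSubmodule h𝔏'' β β' hβ'add hβ'smul
    hcompat (x' := ⟨E'.1, E'.2⟩) (fun h0 => hE'0 (Subtype.ext (congrArg Subtype.val h0))) hrad
  have hβ0 : β = 0 := Literature.Algebra.Lie.InvariantFormSimple.eq_zero_of_isSimple_of_orthogonal hβinv hx0 hxrad
  intro X₁ Y₁
  have h := hβapply X₁ Y₁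
  rw [hβ0, LinearMap.zero_apply, LinearMap.zero_apply] at h
  linear_combination -h


/-- **`8 · tr_{V_ℂ}(x y) = dim_ℚ V · κ_{𝔏'}(x, y)` for all `x, y` in any Lie subalgebra `𝔏' ≤ 𝔤𝔩_ℂ(V_ℂ)` with carrier
`𝔥_ℂ = Lie Hg ⊗ ℂ`** (type-III position, `𝔷 = 0`, `Lie Hg` `ℚ`-simple): the rational identity
`eight_mul_trace_mul_eq_finrank_mul_killingForm` extended `ℂ`-bilinearly (`forall_eq_zero_of_spanC`, `killingForm_spanC`).
In particular it holds on the compact factor `𝔨 ⊂ 𝔥_ℂ`, although `𝔨` contains no non-zero rational element.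
[cite: MoonenZarhin1999LowDim, §2 (2.3)] [cite: Jacobson1962LieAlgebras, Ch. X §1 and Ch. III §4]
[cite: Deligne1982HodgeCycles, I §3 (3.4–3.6)] -/
theorem eight_mul_trace_mul_eq_finrank_mul_killingForm_spanC (H : HodgeStructure V n) (ψ : H.Polarization) (hn : n = 1)
    (e : Module.Basis S ℂ (ℂ ⊗[ℚ] V)) (hF : ∀ a, H.F a = Submodule.span ℂ (e '' {σ | a ≤ deg σ}))
    (hFc : ∀ a, complexConj (H.F a) = Submodule.span ℂ (e '' {σ | deg σ ≤ n - a}))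
    (hdeg : ∀ σ, deg σ = 0 ∨ deg σ = 1) {X : Module.End ℚ V} (hX : X ∈ H.hodgeLie) (hXE : X ∉ H.endAlg)
    (hplus : ∀ Y ∈ H.hodgeLieC, ∃ c : ℂ,
      gradingEnd e deg * Y * (1 - gradingEnd e deg) = c • (gradingEnd e deg * X.baseChange ℂ * (1 - gradingEnd e deg)))
    (hminus : ∀ Y ∈ H.hodgeLieC, ∃ c : ℂ,
      (1 - gradingEnd e deg) * Y * gradingEnd e deg = c • ((1 - gradingEnd e deg) * X.baseChange ℂ * gradingEnd e deg))
    (hz : H.hodgeLie ⊓ Subalgebra.toSubmodule H.endAlg = ⊥)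
    (hsimple : letI : LieRing (Module.End ℚ V) := LieRing.ofAssociativeRing
      ∀ 𝔏 : LieSubalgebra ℚ (Module.End ℚ V), 𝔏.toSubmodule = H.hodgeLie → LieAlgebra.IsSimple ℚ 𝔏) :
    letI : LieRing (Module.End ℂ (ℂ ⊗[ℚ] V)) := LieRing.ofAssociativeRing
    ∀ (𝔏' : LieSubalgebra ℂ (Module.End ℂ (ℂ ⊗[ℚ] V))), 𝔏'.toSubmodule = H.hodgeLieC → ∀ x y : 𝔏',
      8 * LinearMap.trace ℂ (ℂ ⊗[ℚ] V) ((x : Module.End ℂ (ℂ ⊗[ℚ] V)) * y) =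
        (Module.finrank ℚ V : ℂ) * killingForm ℂ 𝔏' x y := by
  letI : LieRing (Module.End ℚ V) := LieRing.ofAssociativeRing
  letI : LieRing (Module.End ℂ (ℂ ⊗[ℚ] V)) := LieRing.ofAssociativeRing
  intro 𝔏' h𝔏' x y
  classical
  -- the rational Lie algebra and the rational identity
  obtain ⟨𝔏, h𝔏⟩ : ∃ 𝔏 : LieSubalgebra ℚ (Module.End ℚ V), 𝔏.toSubmodule = H.hodgeLie :=
    ⟨{ H.hodgeLie with
        lie_mem' := fun {a b} ha hb => by
          rw [LieRing.of_associative_ring_bracket]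
          exact H.commutator_mem_hodgeLie ha hb }, rfl⟩
  have hrat := eight_mul_trace_mul_eq_finrank_mul_killingForm H ψ hn e hF hFc hdeg hX hXE hplus hminus hz hsimple 𝔏 h𝔏
  have h𝔏'' : 𝔏'.toSubmodule = spanC 𝔏.toSubmodule := by rw [h𝔏', h𝔏, hodgeLieC_eq_spanC]
  -- the rational form `β = 8 τ − d κ` vanishes
  obtain ⟨β, hβ⟩ : ∃ β : LinearMap.BilinForm ℚ 𝔏,
      β = (8 : ℚ) • LieModule.traceForm ℚ 𝔏 V - (Module.finrank ℚ V : ℚ) • killingForm ℚ 𝔏 := ⟨_, rfl⟩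
  have hβapply : ∀ X₁ Y₁ : 𝔏, β X₁ Y₁ =
      8 * LinearMap.trace ℚ V ((X₁ : Module.End ℚ V) * Y₁) - (Module.finrank ℚ V : ℚ) * killingForm ℚ 𝔏 X₁ Y₁ := by
    intro X₁ Y₁
    rw [hβ, LinearMap.sub_apply, LinearMap.smul_apply, LinearMap.smul_apply, LinearMap.sub_apply, LinearMap.smul_apply,
      LinearMap.smul_apply, LieModule.traceForm_apply_apply, smul_eq_mul, smul_eq_mul]
    rfl
  have hβ0 : ∀ X₁ Y₁ : 𝔏, β X₁ Y₁ = 0 := fun X₁ Y₁ => by rw [hβapply, hrat X₁ Y₁, sub_self]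
  -- the complex form and its compatibility
  obtain ⟨β', hβ'⟩ : ∃ β' : 𝔏'.toSubmodule → 𝔏'.toSubmodule → ℂ, ∀ x y, β' x y =
      8 * LinearMap.trace ℂ (ℂ ⊗[ℚ] V) ((x : Module.End ℂ (ℂ ⊗[ℚ] V)) * y) -
        (Module.finrank ℚ V : ℂ) * killingForm ℂ 𝔏' ⟨x.1, x.2⟩ ⟨y.1, y.2⟩ := ⟨_, fun _ _ => rfl⟩
  have hβ'add : ∀ y x x' : 𝔏'.toSubmodule, β' y (x + x') = β' y x + β' y x' := by
    intro y x x'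
    have hsplit : (⟨(x + x').1, (x + x').2⟩ : 𝔏') = ⟨x.1, x.2⟩ + ⟨x'.1, x'.2⟩ := rfl
    rw [hβ', hβ', hβ', hsplit, map_add, Submodule.coe_add, mul_add, map_add]
    ring
  have hβ'smul : ∀ (c : ℂ) (y x : 𝔏'.toSubmodule), β' y (c • x) = c * β' y x := by
    intro c y x
    have hsplit : (⟨(c • x).1, (c • x).2⟩ : 𝔏') = c • ⟨x.1, x.2⟩ := rfl
    rw [hβ', hβ', hsplit, map_smul, Submodule.coe_smul, mul_smul_comm, map_smul, smul_eq_mul, smul_eq_mul]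
    ring
  have hβ'add' : ∀ x x' y : 𝔏'.toSubmodule, β' (x + x') y = β' x y + β' x' y := by
    intro x x' y
    have hsplit : (⟨(x + x').1, (x + x').2⟩ : 𝔏') = ⟨x.1, x.2⟩ + ⟨x'.1, x'.2⟩ := rfl
    rw [hβ', hβ', hβ', hsplit, LinearMap.map_add₂, Submodule.coe_add, add_mul, map_add]
    ring
  have hβ'smul' : ∀ (c : ℂ) (x y : 𝔏'.toSubmodule), β' (c • x) y = c * β' x y := by
    intro c x y
    have hsplit : (⟨(c • x).1, (c • x).2⟩ : 𝔏') = c • ⟨x.1, x.2⟩ := rfl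
    rw [hβ', hβ', hsplit, LinearMap.map_smul₂, Submodule.coe_smul, smul_mul_assoc, map_smul, smul_eq_mul, smul_eq_mul]
    ring
  have hcompat : ∀ (X₁ Y₁ : 𝔏.toSubmodule) (hX₁ : (X₁ : Module.End ℚ V).baseChange ℂ ∈ 𝔏'.toSubmodule)
      (hY₁ : (Y₁ : Module.End ℚ V).baseChange ℂ ∈ 𝔏'.toSubmodule), β' ⟨_, hX₁⟩ ⟨_, hY₁⟩ = algebraMap ℚ ℂ (β X₁ Y₁) := by
    intro X₁ Y₁ hX₁ hY₁
    have hK := killingForm_spanC 𝔏 𝔏' h𝔏'' X₁ Y₁ ⟨_, hX₁⟩ ⟨_, hY₁⟩ rfl rfl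
    rw [hβ', hβapply]
    change 8 * LinearMap.trace ℂ (ℂ ⊗[ℚ] V) ((X₁ : Module.End ℚ V).baseChange ℂ * (Y₁ : Module.End ℚ V).baseChange ℂ) -
      (Module.finrank ℚ V : ℂ) * killingForm ℂ 𝔏' ⟨_, hX₁⟩ ⟨_, hY₁⟩ = _
    rw [hK, ← LinearMap.baseChange_mul, LinearMap.trace_baseChange]
    simp only [map_sub, map_mul, map_natCast, map_ofNat]
  -- ascent
  have h := forall_eq_zero_of_spanC 𝔏.toSubmodule 𝔏'.toSubmodule h𝔏'' β β' hβ'add hβ'smul hβ'add' hβ'smul' hcompat hβ0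
    ⟨x.1, x.2⟩ ⟨y.1, y.2⟩
  have hxe : (⟨x.1, x.2⟩ : 𝔏') = x := rfl
  have hye : (⟨y.1, y.2⟩ : 𝔏') = y := rfl
  simp only [hβ', hxe, hye] at h
  linear_combination h

end HodgeStructure

end Literature.AlgebraicGeometry.Motives

end
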